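/-
Copyright: the b2b-balaban cell (near-miss cell 7), T⁴-continuum fan-out, lineage t4-ne7b-p2 (node U5c RENEWAL member).
Released under the licence of the surrounding project.
-/
import Summits.QuantumFields.BalabanUV.T4Continuum.Support.RenewalRecordsForest

/-!
# Spine records, END: every ledger fact PROVED, the two per-slot bounds from two catalogues only

Summits-side support leaf of the T⁴-continuum cell (rung (B)+1 on a FINITE torus only; NOT infinite volume, NOT the
mass gap, NOT the Clay statement; NOT a proof of the spine estimate NE7b).  Lineage `t4-ne7b-p2` (generation 23),
node U5c, RENEWAL route; leaf N4b of the ROUND-2 skeleton `t4/skeletons/NE7b-t4-ne7b-p2.md` v1.7 on the carriers of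
`RenewalRecords` ∕ `RenewalRecordsForest`: ONE generic instantiation of `RenewalGroveSum.sum_le_of_grove_product` ∕
`RenewalTiltedForest.sum_tilted_le_of_grove_product`.  [folklore] finite combinatorics; nothing is quoted from print,
nothing printed is asserted, no `[cite:]` tag; none of the cell's conditionals ((B), BetaPertH) occurs.

WHAT.  §7 THE TWO ENDS: `sum_weight_tilted_le` (the pending product-majorant mass WEIGHTED BY
`z₁^(reach − (j + Ah))` is `≤ (B₀·D∕η)·(z⁻¹)^Ah`, `D = 1∕(1 − z₁⁻¹z)`) and `sum_weight_le` (the plain mass, same bound)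
from: validity, ages `≤ Ah`, reach beyond the cutoff, root catalogue mass `≤ B₀`, block catalogue mass `≤ εc`
parent-uniformly, slack — NOTHING ELSE (no ledger hypothesis, no relative price).  §8 a decided toy (one renewal edge
on the dictionary's sanity windows), every hypothesis at once.

WHAT THIS LEAVES to the instantiating seat (skeleton v1.7): the PROJECTION of the COUNT road's physical genealogies
(`HistoryAdmissible.PGen`, oriented at the oldest constituent) to spine records with `Valid` and the reach law (N1c,
reading (ID) shared with the COUNT road); the two catalogue inequalities (N3, on the landed cores `RenewalRootMass`,
`RenewalEdgeMass`, `RenewalCatalogue`, `RenewalMultiJoin`, with the partner mass from N5⁺ by induction on the cutoff —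
the tilted END is the induction's currency); the slack arithmetic (N3e).

HONEST DEPENDENCY (cell): continuum YM on T⁴ ⇐ BetaPertH ∧ nine spine estimates (0/9 proved); BetaPertH ⇐ (D1) ∧ (D4)
∧ CAP+tail.  This file changes none of it.
-/

open Finset
open Literature.MathematicalPhysics.QuantumFieldTheory.Balaban1983to89
open T4PersistenceDictionary T4PersistenceRenewal T4PersistenceGrove
open Summit.QuantumFields.BalabanUV.T4Continuum.RenewalGroveSum
open Summit.QuantumFields.BalabanUV.T4Continuum.RenewalTiltedForest

namespace Summit.QuantumFields.BalabanUV.T4Continuum.RenewalRecords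
/-! ## §7 The two ENDs: the per-slot bounds of the renewal route from validity, pendingness and two catalogues -/

section End

variable {ε : Type*} [DecidableEq ε]

/-- **THE TILTED PER-SLOT BOUND ON SPINE RECORDS.**  DATA: windows `W`, birth step `j`, horizon `Ah` (cutoff
`j + Ah`), a finite family `Pend` of spine records, root prices `ρ ≥ 0`, block prices `π ≥ 0`, tilts `1 ≤ z < z₁`,
`0 < η`, slack `εc·(z∕z₁)∕(1 − z∕z₁) ≤ 1 − η`.  HYPOTHESES: every pending record is VALID, has its events by the cutoff
(`last ≤ Ah`) and its tree REACHES BEYOND the cutoff (`j + Ah < reach`); a ROOT CATALOGUE `Roots ∋ (root, tail)` of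
paired mass `Σ ρ·z₁^(W root + window tail) ≤ B₀`; a BLOCK CATALOGUE `Cat P s ∋ (first, rest)` for the newest block of
every component, of paired mass `Σ π s block·z₁^(window block) ≤ εc` for every parent `P` and age `s`.  CONCLUSION:
`Σ_{r ∈ Pend} weight r·z₁^(reach (tree r) − (j + Ah)) ≤ (B₀·(1∕(1 − z₁⁻¹z))∕η)·(z⁻¹)^Ah`.
Proof: `RenewalTiltedForest.sum_tilted_le_of_grove_product` on the prefix forest with singleton groves, every ledger
fact discharged in §6. [folklore] -/
theorem sum_weight_tilted_le (W : ε → ℕ) (j Ah : ℕ) (Pend : Finset (Rec ε))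
    (ρ : ε → List (Move ε) → ℝ) (π : ℕ → List (Move ε) → ℝ) (hρ : ∀ b t, 0 ≤ ρ b t) (hπ : ∀ s b, 0 ≤ π s b)
    {z z₁ η B₀ εc : ℝ} (hz : 1 ≤ z) (hzz : z < z₁) (hε : 0 ≤ εc) (hη : 0 < η) (hB₀ : 0 ≤ B₀)
    (hslack : εc * ((z / z₁) / (1 - z / z₁)) ≤ 1 - η)
    (hvalid : ∀ r ∈ Pend, r.Valid W j) (hlast : ∀ r ∈ Pend, r.last ≤ Ah)
    (hpend : ∀ r ∈ Pend, j + Ah < (r.tree j).reach W)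
    (Roots : Finset (ε × List (Move ε))) (hroots : ∀ r ∈ Pend, (r.root, r.tail) ∈ Roots)
    (hB : ∑ p ∈ Roots, ρ p.1 p.2 * z₁ ^ (W p.1 + blockWindow W p.2) ≤ B₀)
    (Cat : Rec ε → ℕ → Finset (Move ε × List (Move ε)))
    (hmem : ∀ c ∈ (forest Pend).Cmp, ∀ e es, c.hist = e :: es → (e.first, e.rest) ∈ Cat c.parent c.last)
    (hcat : ∀ P s, ∑ p ∈ Cat P s, π s (p.1 :: p.2) * z₁ ^ blockWindow W (p.1 :: p.2) ≤ εc) :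
    ∑ r ∈ Pend, r.weight ρ π * z₁ ^ ((r.tree j).reach W - (j + Ah)) ≤
      B₀ * (1 / (1 - z₁⁻¹ * z)) / η * (z⁻¹) ^ Ah := by
  have hz₁ : 0 ≤ z₁ := le_trans zero_le_one (hz.trans hzz.le)
  have h := sum_tilted_le_of_grove_product (forest Pend) (Rec.weight ρ π) (Rec.price ρ π) W j
    (fun c => ({c.tree j} : Grove ε)) Rec.ev (Rec.tailEv j) hz hzz hε hη hB₀ (subset_Cmp Pend)
    (fun c hc => last_le_forest hlast hc) (fun c _ => Rec.weight_nonneg hρ hπ c) hslack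
    (fun c hc hr => hroot_forest W j hvalid hc hr) (fun c _ hr => weight_root_forest ρ π hr)
    (fun c hc hr => weight_step_forest ρ π hc hr) (rootMass_le W j ρ π hρ hπ hz₁ Roots hroots hB)
    (fun c hc hr => hstep_forest W j hvalid hc hr)
    (fun P _ s _ hs => catalogue_le W j ρ π hρ hπ hz₁ Cat hmem hcat hs)
    (fun c hc => by simpa using hpend c hc)
  simpa using h

/-- **THE PLAIN PER-SLOT BOUND ON SPINE RECORDS**: under the same hypotheses,
`Σ_{r ∈ Pend} weight r ≤ (B₀·(1∕(1 − z₁⁻¹z))∕η)·(z⁻¹)^Ah` (the plain mass is below the tilted one). [folklore] -/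
theorem sum_weight_le (W : ε → ℕ) (j Ah : ℕ) (Pend : Finset (Rec ε))
    (ρ : ε → List (Move ε) → ℝ) (π : ℕ → List (Move ε) → ℝ) (hρ : ∀ b t, 0 ≤ ρ b t) (hπ : ∀ s b, 0 ≤ π s b)
    {z z₁ η B₀ εc : ℝ} (hz : 1 ≤ z) (hzz : z < z₁) (hε : 0 ≤ εc) (hη : 0 < η) (hB₀ : 0 ≤ B₀)
    (hslack : εc * ((z / z₁) / (1 - z / z₁)) ≤ 1 - η)
    (hvalid : ∀ r ∈ Pend, r.Valid W j) (hlast : ∀ r ∈ Pend, r.last ≤ Ah)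
    (hpend : ∀ r ∈ Pend, j + Ah < (r.tree j).reach W)
    (Roots : Finset (ε × List (Move ε))) (hroots : ∀ r ∈ Pend, (r.root, r.tail) ∈ Roots)
    (hB : ∑ p ∈ Roots, ρ p.1 p.2 * z₁ ^ (W p.1 + blockWindow W p.2) ≤ B₀)
    (Cat : Rec ε → ℕ → Finset (Move ε × List (Move ε)))
    (hmem : ∀ c ∈ (forest Pend).Cmp, ∀ e es, c.hist = e :: es → (e.first, e.rest) ∈ Cat c.parent c.last)
    (hcat : ∀ P s, ∑ p ∈ Cat P s, π s (p.1 :: p.2) * z₁ ^ blockWindow W (p.1 :: p.2) ≤ εc) :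
    ∑ r ∈ Pend, r.weight ρ π ≤ B₀ * (1 / (1 - z₁⁻¹ * z)) / η * (z⁻¹) ^ Ah :=
  (sum_le_sum_tilted (Ah := Ah) (j := j) (Rec.weight ρ π) W (fun c => ({c.tree j} : Grove ε)) (hz.trans hzz.le)
      (fun c _ => Rec.weight_nonneg hρ hπ c)).trans (by
    simpa using sum_weight_tilted_le W j Ah Pend ρ π hρ hπ hz hzz hε hη hB₀ hslack hvalid hlast hpend Roots hroots
      hB Cat hmem hcat)

end End

/-! ## §8 A decided toy: one renewal edge on the dictionary's sanity windows -/

section Toy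

/-- **THE TOY RECORD** on the dictionary's sanity windows `W₀ = (3, 4, 2)`, birth step `j = 0`: root label `0`
(tree `born 0 0`, reach `3`), empty root block, ONE edge — gap `1`, block `[renew 1]` — i.e. a renewal at age `2`
(ready at step `1 < 3`, renewed at `2`, reach `2 + W₀ 1 = 6`).  (A notation, so that this file stays definition-free.)
[folklore] -/
local notation "toyRec" => (Rec.mk (0 : ℕ) [] [Edge.mk 1 (Move.renew 1) []])

/-- the toy record is valid and its tree reaches `6` [folklore] -/
theorem toyRec_valid : Rec.Valid W₀ 0 toyRec ∧ (Rec.tree 0 toyRec).reach W₀ = 6 ∧ Rec.last toyRec = 2 := by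
  refine ⟨⟨trivial, trivial, ?_, trivial⟩, ?_, rfl⟩
  · show 1 ≤ 0 + (0 + 1 + 1) ∧ 0 + (0 + 1 + 1) ≤ (Gen.born 0 0).reach W₀
    simp [W₀]
  · simp [Rec.tree, treeOf, rootTree, applyBlock, Edge.block, endAge, Move.apply, W₀]

/-- **EVERY HYPOTHESIS AT ONCE**: `Pend = {toyRec}`, horizon `Ah = 4` (the tree reaches `6 > 0 + 4`), prices
`ρ = 1∕64`, `π = 1∕1024`, tilts `z = 2 < z₁ = 4`, `η = 3∕4`, root catalogue `{(0, [])}` of mass `(1∕64)·4³ = 1 = B₀`,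
block catalogue `{(renew 1, [])}` of mass `(1∕1024)·4⁴ = 1∕4 = εc`, slack `(1∕4)·((2∕4)∕(1 − 2∕4)) ≤ 1 − 3∕4`:
the tilted pending mass `(1∕1024)·(1∕64)·4^(6 − 4) = 1∕4096 ≤ (1·(1∕(1 − 4⁻¹·2))∕(3∕4))·(2⁻¹)^4 = 1∕6`. [folklore] -/
theorem toy_tilted :
    ∑ r ∈ ({toyRec} : Finset (Rec ℕ)), r.weight (fun _ _ => (1 : ℝ) / 64) (fun _ _ => 1 / 1024) *
        (4 : ℝ) ^ ((r.tree 0).reach W₀ - (0 + 4)) ≤ 1 * (1 / (1 - (4 : ℝ)⁻¹ * 2)) / (3 / 4) * ((2 : ℝ)⁻¹) ^ 4 := by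
  refine sum_weight_tilted_le W₀ 0 4 {toyRec} (fun _ _ => (1 : ℝ) / 64) (fun _ _ => 1 / 1024) (by norm_num)
    (by norm_num) (εc := 1 / 4) (by norm_num) (by norm_num) (by norm_num) (by norm_num) (by norm_num) (by norm_num)
    ?_ ?_ ?_ {(0, [])} ?_ ?_ (fun _ _ => {(Move.renew 1, [])}) ?_ ?_
  · intro r hr; rw [mem_singleton] at hr; subst hr; exact toyRec_valid.1
  · intro r hr; rw [mem_singleton] at hr; subst hr; rw [toyRec_valid.2.2]; norm_num
  · intro r hr; rw [mem_singleton] at hr; subst hr; rw [toyRec_valid.2.1]; norm_num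
  · intro r hr; rw [mem_singleton] at hr; subst hr; exact mem_singleton_self _
  · simp [blockWindow, W₀]; norm_num
  · intro c hc e es he
    obtain ⟨r, hr, n, hn, rfl⟩ := mem_Cmp.1 hc
    rw [mem_singleton] at hr
    subst hr
    simp only [List.length_singleton] at hn
    interval_cases n
    · simp only [Rec.cut, List.drop_zero, List.cons.injEq] at he
      obtain ⟨rfl, -⟩ := he
      exact mem_singleton_self _
    · simp [Rec.cut] at he
  · intro P s
    simp [blockWindow, Move.window, W₀]
    norm_num

/-- the numbers of the toy, decided: reach `6`, tilted mass `16∕65536 = 1∕4096 ≤ 1∕6`, root mass `1`, block mass `1∕4` -/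
example : (1 : ℚ) / 1024 * (1 / 64) * 4 ^ (6 - (0 + 4)) = 1 / 4096 ∧
    (1 : ℚ) / 4096 ≤ 1 * (1 / (1 - 1 / 4 * 2)) / (3 / 4) * (1 / 2) ^ 4 ∧ (1 : ℚ) / 64 * 4 ^ (3 + 0) = 1 ∧
    (1 : ℚ) / 1024 * 4 ^ (4 + 0) = 1 / 4 := by
  norm_num

end Toy


end Summit.QuantumFields.BalabanUV.T4Continuum.RenewalRecords
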